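import Mathlib
import HarnessLib

/-!
# WeilTypeLadder · compact orderings I: the greedy lemma and the list surgery (any abelian group)

b2b cell `hweil` (packet `run/shared/lean/b2b/hodge-weil/`, report `b2b-hweil-pv3-g42/COMPACT-CRITERION.md`, prover 3
generation 42). PURE COMBINATORICS in an additive commutative group; no geometry, no named fact, no `decide`.

A COMPACT ORDERING of a multiset of letters (rotation numbers `β₁, …, β_N` of a cyclic cover of `ℙ¹`, `Σ βᵢ = 0`) is an
ordering all of whose PROPER prefix sums are non-zero (`∀ k, 0 < k → k < l.length → (l.take k).sum ≠ 0`), the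
hypothesis of the packet's comb degeneration (THEOREM DISC-PIECES) and the object of OBSERVATION CO ([P3-g41] §5).
This file is part I of THEOREM ORD (the complete criterion, `…CompactOrderingCriterion`):

* `exists_ordering_prefixSum_ne_zero_of_two_mul_count_le` / `exists_compactOrdering_of_two_mul_count_le` — **the greedy
  lemma**: a zero-sum multiset of non-zero letters in which NO letter occurs more than `(N+1)/2` times is compactly
  orderable, in ANY abelian group (play a most frequent letter unless it cancels the state; then another one first);
* `compactOrdering_unmerge` (split a letter `x + y` back into `x, y` or `y, x`), `compactOrdering_insert_pair` (insert
  `x, -x` behind the first letter), `prefixSum_cons_ne_zero`, `count_add_count_le_card`, `coe_append_cons` — the list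
  surgery used by the induction of part III.

HONEST LABEL: bookkeeping (combinatorics of rotation tuples); 0 rungs; nothing of Markman 2025 / Mostaed 2026 /
Perry 2026 is used; no kit job.
-/

-- every declaration of this problem lives in `Summit.HodgeConjecture.HodgeConjecture.…` (summit = sub-problem)
set_option linter.dupNamespace false

namespace Summit.HodgeConjecture.HodgeConjecture.WeilTypeLadder

open Multiset

section General

variable {G : Type*} [AddCommGroup G]

/-- Prefix sums after a first letter: if `s + v ≠ 0` and the prefix sums of `l` from the state `s + v` avoid `0`, then
the prefix sums of `v :: l` from the state `s` avoid `0`. [folklore] -/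
theorem prefixSum_cons_ne_zero (s v : G) (l : List G) (hv : s + v ≠ 0)
    (h : ∀ k, 0 < k → k < l.length → s + v + (l.take k).sum ≠ 0) :
    ∀ k, 0 < k → k < (v :: l).length → s + ((v :: l).take k).sum ≠ 0 := by
  intro k hk hkl
  obtain ⟨j, rfl⟩ : ∃ j, k = j + 1 := ⟨k - 1, by omega⟩
  rw [List.take_succ_cons, List.sum_cons, ← add_assoc]
  rcases Nat.eq_zero_or_pos j with h0 | hpos
  · subst h0; simpa using hv
  · exact h j hpos (by simp at hkl; omega)

/-- **Un-merging.** If `P ++ (x + y) :: R` has all proper prefix sums non-zero and `P.sum + x ≠ 0`, then so has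
`P ++ x :: y :: R` (the prefixes ending inside `P` or beyond `y` have the old sums). [folklore] -/
theorem compactOrdering_unmerge (P R : List G) (x y : G)
    (hc : ∀ k, 0 < k → k < (P ++ (x + y) :: R).length → ((P ++ (x + y) :: R).take k).sum ≠ 0)
    (hx : P.sum + x ≠ 0) :
    ∀ k, 0 < k → k < (P ++ x :: y :: R).length → ((P ++ x :: y :: R).take k).sum ≠ 0 := by
  intro k hk hkl
  simp only [List.length_append, List.length_cons] at hkl hc
  rw [List.take_append]
  by_cases h1 : k ≤ P.length
  · have e : k - P.length = 0 := by omega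
    rw [e, List.take_zero, List.append_nil]
    have := hc k hk (by omega)
    rwa [List.take_append, e, List.take_zero, List.append_nil] at this
  · by_cases h2 : k = P.length + 1
    · subst h2
      rw [List.take_of_length_le (le_of_lt (Nat.lt_succ_self _)), Nat.add_sub_cancel_left,
        List.take_succ_cons, List.take_zero, List.sum_append, List.sum_singleton]
      exact hx
    · obtain ⟨j, hj⟩ : ∃ j, k - P.length = j + 2 := ⟨k - P.length - 2, by omega⟩
      rw [List.take_of_length_le (by omega), hj, List.take_succ_cons, List.take_succ_cons, List.sum_append,
        List.sum_cons, List.sum_cons]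
      have := hc (k - 1) (by omega) (by omega)
      have e : k - 1 - P.length = j + 1 := by omega
      rw [List.take_append, List.take_of_length_le (by omega), e, List.take_succ_cons, List.sum_append,
        List.sum_cons] at this
      have e2 : P.sum + (x + (y + (R.take j).sum)) = P.sum + (x + y + (R.take j).sum) := by abel
      rw [e2]; exact this

/-- **Inserting an inverse pair behind the first letter.** If `a :: t` has all proper prefix sums non-zero, `a ≠ 0`
and `a + x ≠ 0`, then `a :: x :: (-x) :: t` has all proper prefix sums non-zero. [folklore] -/
theorem compactOrdering_insert_pair (a x : G) (t : List G) (ha : a ≠ 0) (hx : a + x ≠ 0)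
    (hc : ∀ k, 0 < k → k < (a :: t).length → ((a :: t).take k).sum ≠ 0) :
    ∀ k, 0 < k → k < (a :: x :: (-x) :: t).length → ((a :: x :: (-x) :: t).take k).sum ≠ 0 := by
  intro k hk hkl
  simp only [List.length_cons] at hkl hc
  obtain ⟨j, rfl⟩ : ∃ j, k = j + 1 := ⟨k - 1, by omega⟩
  rw [List.take_succ_cons, List.sum_cons]
  rcases j with _ | j
  · simpa using ha
  rw [List.take_succ_cons, List.sum_cons]
  rcases j with _ | j
  · simpa using hx
  rw [List.take_succ_cons, List.sum_cons, add_neg_cancel_left]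
  have := hc (j + 1) (by omega) (by omega)
  rwa [List.take_succ_cons, List.sum_cons] at this

/-- Two distinct letters of a multiset have total multiplicity at most its size. [folklore] -/
theorem count_add_count_le_card {α : Type*} [DecidableEq α] (R : Multiset α) {x v : α} (h : x ≠ v) :
    R.count x + R.count v ≤ card R := by
  have hle : replicate (R.count x) x + replicate (R.count v) v ≤ R := by
    rw [le_iff_count]
    intro a
    rw [count_add, count_replicate, count_replicate]
    by_cases hax : x = a
    · subst hax; simp [Ne.symm h]
    · by_cases hav : v = a
      · subst hav; simp [hax]
      · simp [hax, hav]
  simpa using card_le_card hle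

variable [DecidableEq G]

/-- **No majority letter ⟹ compactly orderable from any state (any abelian group).** If `s + ΣR = 0`, the letters
of `R` are non-zero and no letter occurs more than `(|R| + 1)/2` times, then `R` can be ordered so that all the sums
`s + (proper prefix)` are non-zero. Greedy: play a most frequent letter `v` unless `v = -s`, in which case play
another letter first (and then `v` at once if `v` fills more than half of `R`). [folklore] -/
theorem exists_ordering_prefixSum_ne_zero_of_two_mul_count_le :
    ∀ (n : ℕ) (s : G) (R : Multiset G), card R = n → (∀ x ∈ R, x ≠ 0) → s + R.sum = 0 →
      (∀ x, 2 * R.count x ≤ card R + 1) →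
      ∃ l : List G, (l : Multiset G) = R ∧ ∀ k, 0 < k → k < l.length → s + (l.take k).sum ≠ 0 := by
  intro n
  induction n using Nat.strong_induction_on with
  | _ n ih =>
  intro s R hn h0 hs hcnt
  rcases Nat.eq_zero_or_pos n with rfl | hnpos
  · refine ⟨[], ?_, fun k hk hkl => by simp at hkl⟩
    rw [card_eq_zero] at hn; simp [hn]
  by_cases hn1 : n = 1
  · subst hn1
    obtain ⟨x, rfl⟩ := card_eq_one.mp hn
    exact ⟨[x], by simp, fun k hk hkl => by simp at hkl; omega⟩
  have hR0 : R ≠ 0 := by rintro rfl; simp at hn; omega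
  -- a most frequent letter `v`
  obtain ⟨v, hv, hvmax⟩ := exists_max_image (fun x => R.count x) hR0
  have hle : ∀ x, R.count x ≤ R.count v := by
    intro x
    by_cases hxR : x ∈ R
    · exact hvmax x hxR
    · rw [count_eq_zero.mpr hxR]; exact Nat.zero_le _
  have hcR : card (R.erase v) = n - 1 := by rw [card_erase_of_mem hv, hn]; rfl
  by_cases hsv : s + v ≠ 0
  · -- play `v`
    have hcnt' : ∀ x, 2 * (R.erase v).count x ≤ card (R.erase v) + 1 := by
      intro x
      rw [hcR]
      by_cases hxv : x = v
      · subst hxv; rw [count_erase_self]; have := hcnt x; omega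
      · rw [count_erase_of_ne hxv]
        have h1 := hcnt x
        have h2 := count_add_count_le_card R hxv
        have h3 := hle x
        omega
    have h0' : ∀ x ∈ R.erase v, x ≠ 0 := fun x hx => h0 x (mem_of_mem_erase hx)
    have hs' : s + v + (R.erase v).sum = 0 := by rw [add_assoc, sum_erase hv]; exact hs
    obtain ⟨l, hl, hc⟩ := ih (n - 1) (by omega) (s + v) (R.erase v) hcR h0' hs' hcnt'
    refine ⟨v :: l, ?_, prefixSum_cons_ne_zero s v l hsv hc⟩
    rw [← cons_coe, hl, cons_erase hv]
  · push Not at hsv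
    -- there is a letter `w ≠ v` (otherwise `v` fills `R` and `2n ≤ n + 1`)
    have hw : ∃ w ∈ R, w ≠ v := by
      by_contra hall
      push Not at hall
      have hRrep : R = replicate n v := eq_replicate.mpr ⟨hn, hall⟩
      have := hcnt v
      rw [hRrep, count_replicate_self, card_replicate] at this
      omega
    obtain ⟨w, hw, hwv⟩ := hw
    have hw0 : w ≠ 0 := h0 w hw
    have hsw : s + w ≠ 0 := fun h => hwv (add_left_cancel (h.trans hsv.symm))
    have hcRw : card (R.erase w) = n - 1 := by rw [card_erase_of_mem hw, hn]; rfl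
    by_cases hcv : 2 * R.count v ≤ n
    · -- play `w`
      have hcnt' : ∀ x, 2 * (R.erase w).count x ≤ card (R.erase w) + 1 := by
        intro x
        rw [hcRw]
        by_cases hxw : x = w
        · subst hxw; rw [count_erase_self]; have := hcnt x; omega
        · rw [count_erase_of_ne hxw]; have := hle x; omega
      have h0' : ∀ x ∈ R.erase w, x ≠ 0 := fun x hx => h0 x (mem_of_mem_erase hx)
      have hs' : s + w + (R.erase w).sum = 0 := by rw [add_assoc, sum_erase hw]; exact hs
      obtain ⟨l, hl, hc⟩ := ih (n - 1) (by omega) (s + w) (R.erase w) hcRw h0' hs' hcnt'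
      refine ⟨w :: l, ?_, prefixSum_cons_ne_zero s w l hsw hc⟩
      rw [← cons_coe, hl, cons_erase hw]
    · -- play `w`, then `v`
      have hcv' : 2 * R.count v = n + 1 := by have := hcnt v; omega
      have hvw : v ∈ R.erase w := (mem_erase_of_ne (Ne.symm hwv)).mpr hv
      have hcR2 : card ((R.erase w).erase v) = n - 2 := by
        rw [card_erase_of_mem hvw, hcRw]; rfl
      have hcnt' : ∀ x, 2 * ((R.erase w).erase v).count x ≤ card ((R.erase w).erase v) + 1 := by
        intro x
        rw [hcR2]
        by_cases hxv : x = v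
        · subst hxv
          rw [count_erase_self, count_erase_of_ne (Ne.symm hwv)]
          omega
        · rw [count_erase_of_ne hxv]
          have h2 := count_add_count_le_card R hxv
          by_cases hxw : x = w
          · subst hxw; rw [count_erase_self]; omega
          · rw [count_erase_of_ne hxw]; omega
      have h0' : ∀ x ∈ (R.erase w).erase v, x ≠ 0 :=
        fun x hx => h0 x (mem_of_mem_erase (mem_of_mem_erase hx))
      have hs' : s + w + v + ((R.erase w).erase v).sum = 0 := by
        rw [add_assoc, add_assoc, sum_erase hvw, sum_erase hw]; exact hs
      have hswv : s + w + v ≠ 0 := by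
        rw [add_right_comm, hsv, zero_add]; exact hw0
      obtain ⟨l, hl, hc⟩ := ih (n - 2) (by omega) (s + w + v) ((R.erase w).erase v) hcR2 h0' hs' hcnt'
      refine ⟨w :: v :: l, ?_, prefixSum_cons_ne_zero s w (v :: l) hsw (prefixSum_cons_ne_zero (s + w) v l hswv hc)⟩
      rw [← cons_coe, ← cons_coe, hl, cons_erase hvw, cons_erase hw]

/-- **COROLLARY (no majority letter).** A zero-sum multiset of non-zero letters in which no letter occurs more than
`(N + 1)/2` times (`N` = its size) has a COMPACT ORDERING: an ordering all of whose proper prefix sums are non-zero.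
Any abelian group. [folklore] -/
theorem exists_compactOrdering_of_two_mul_count_le (R : Multiset G) (h0 : ∀ x ∈ R, x ≠ 0) (hs : R.sum = 0)
    (hcnt : ∀ x, 2 * R.count x ≤ card R + 1) :
    ∃ l : List G, (l : Multiset G) = R ∧ ∀ k, 0 < k → k < l.length → (l.take k).sum ≠ 0 := by
  obtain ⟨l, hl, hc⟩ :=
    exists_ordering_prefixSum_ne_zero_of_two_mul_count_le (card R) 0 R rfl h0 (by simpa using hs) hcnt
  exact ⟨l, hl, fun k hk hkl => by simpa using hc k hk hkl⟩

/-- Moving a letter to the front does not change the underlying multiset. [folklore] -/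
theorem coe_append_cons {α : Type*} (P R : List α) (a : α) :
    (↑(P ++ a :: R) : Multiset α) = a ::ₘ (↑(P ++ R) : Multiset α) := by
  rw [Multiset.cons_coe]; exact Multiset.coe_eq_coe.mpr List.perm_middle

end General

end Summit.HodgeConjecture.HodgeConjecture.WeilTypeLadder
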